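import Summits.BirchSwinnertonDyer.BirchSwinnertonDyer.Theorems.KimAtThreeShallowEqDeepOffStratumSockets
import HarnessLib

/-!
# Route `KimAtThreeKolyvagin` (rung W2), crux `ShallowEqDeepOffKatoStratum` (item 19599, §S child of
# `ShallowEqDeepAtTorsionFree` 19077): the CRUX-LEVEL residual display — modulo its two deep twins the
# crux is ONE all-levels divisibility statement (R), Kim's clause (6) lower-bound half at `p = 3`, and
# (R) is implied by the route's own leaf

Cell `bsd-addord`, seat `bsd-addord-w2-c4` (gen 6, owner of item `stmt-BirchSwinnertonDyer-19599`).
Notation on one tower row (`W₀` globally minimal, `D₀` a lattice-optimal degree-minimal parametrisation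
datum at the conductor, `f = D₀.f`): `a = ∂⁽⁰⁾(δ̃)` (`kuriharaPartial W₀ 3 f 0`), `s = ord₃ #Ш(E/ℚ)(3)`,
`d = ∂^{(∞)}_{deep}(δ̃)` (`kuriharaPartialDeepInfty`), `∂ = ∂^{(∞)}(δ̃)` (`kuriharaPartialInfty`, ALL cyclic
levels). The three off-Kato-stratum cruxes of the route read, at a row: UPPER twin
`DeepUpperAtThreeOffKatoStratum` (19562) `s + d ≤ a`; LOWER twin `DeepLowerAtThreeOffKatoStratum` (19679)
`a ≤ s + d`; THIS crux (19599) `d ≤ ∂`.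

THE DISPLAYED RESIDUAL (R) (hypothesis `hR` below, binders of the crux VERBATIM, conclusion
`a ≤ s + ∂`): «on every off-stratum tower row with `E(ℚ₃)[3] = 0`, EVERY cyclic-level Kurihara number is
divisible by `3^{a − s}`», i.e. `ord₃ δ̃_1 − ord₃ #Ш(E/ℚ)[3^∞] ≤ ord₃ δ̃_n` for every cyclic `n ∈ 𝒩₁`;
equivalently «a certificate `δ̃_n ∉ 3^j ℤ₃/I_n` forces `length Ш[3^∞] ≥ ∂⁽⁰⁾ − j + 1`» — the LOWER-BOUND
half of Kim's clause (6) `length_{ℤ_p} Ш[p^∞] = ∂⁽⁰⁾(δ̃) − ∂^{(∞)}(δ̃)` (C.-H. Kim, Amer. J. Math. 148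
(2026) Thm. 1.9 (6), PRINTED for `p ≥ 5`; the tree's `p ≥ 5` fact in certificate currency is
`Kim2026.rankZero_le_padicValNat_sha_of_kuriharaNumber_ne_zero`; at `p = 3` it is a special case of the
ANNOUNCED Kim 2025 Thm. 1.1, inadmissible as an input in this cell).

* §1 `shallowEqDeepOffKatoStratum_of_deepUpperOff_of_residual`: 19562 ∧ (R) ⟹ 19599 (the crux BY NAME).
* §1 `residual_of_deepLowerOff_of_shallowEqDeepOff`: 19679 ∧ 19599 ⟹ (R) (necessity).
* §1 `deepLowerOff_torsionFree_of_residual`: (R) ⟹ the LOWER twin 19679 on its `E(ℚ₃)[3] = 0` rows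
  (`∂ ≤ d` always). Hence, GRANTED the upper twin 19562: {19599, 19679 restricted to `t = 0`} ⟺ (R)
  (`shallowEqDeepOffKatoStratum_iff_residual_of_twins`): the off-stratum family at `t = 0` has exactly TWO
  irreducible parts, 19562 and (R).
* §2 `residual_of_leaf`: (R) is implied by the route's LEAF `N11.KimAtThreeRankZeroPUB` (which gives
  `a = s + ∂` on every tower row with `t = 0`) — so (R) is NECESSARY for the target the route closes, and
  splitting 19599 as «19562-part + (R)» loses nothing (a sanity edge on the STATEMENT (R), not a proving
  road: the leaf is the route's target and is never an input).

HONEST FRAMING. Theorems only (pure `ℕ∞` bookkeeping over w2-c4 g5's row sockets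
`KimAtThreeShallowEqDeepOffStratumSockets`); the sibling cruxes, the leaf and (R) enter only as displayed
hypotheses BY NAME / verbatim; nothing is asserted about any curve, nothing is booked, crux 19599 and its
parent 19077 stay OPEN; BSD is not proved by any of this. (R) is NOT in print at `p = 3`: for Kato's
Kolyvagin system the all-levels divisibility is Mazur–Rubin Thm. 5.2.12 (i) and reaches `δ̃` only through
a Kato–Kurihara dictionary at a non-additive / IV/IV* / `3 ∣ c₀` prime `3` (definition item
`defn-KatoKuriharaDictionaryThreeNonAddAt`, planner 2026-08-26).

References: [Kim2022StructureSelmer] Thm. 1.9 (6), §1.5.1, Def. 2.13; [Kim2025RefinedTNC] Thm. 1.1/1.2;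
[MazurRubin2004] Def. 4.5.7, Def. 5.2.11, Thm. 5.2.12 (i).
-/

set_option autoImplicit false
-- the Theorems namespace of a single-conjunct summit repeats the summit name by design (D-0017)
set_option linter.dupNamespace false

noncomputable section

open scoped MatrixGroups ModularForm Classical

open CongruenceSubgroup WeierstrassCurve Literature.NumberTheory.EllipticCurves
  Literature.NumberTheory.EllipticCurves.ModularForms
  Literature.NumberTheory.EllipticCurves.Rank1Residual

namespace Summit.BirchSwinnertonDyer.BirchSwinnertonDyer.Theorems.KimAtThreeShallowEqDeepOffStratumResidual

open Summit.BirchSwinnertonDyer.Rank1Residual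
open Summit.BirchSwinnertonDyer.BirchSwinnertonDyer.Theses.KimAtThreeKolyvagin
open Summit.BirchSwinnertonDyer.BirchSwinnertonDyer.Theorems.KimAtThreeKolyvaginUnitLevelOneRungs
open Summit.BirchSwinnertonDyer.BirchSwinnertonDyer.Theorems.KimAtThreeKolyvaginCertificateDictionary
open Summit.BirchSwinnertonDyer.BirchSwinnertonDyer.Theorems.KimAtThreeShallowEqDeepOffStratumSockets

/-! ### §1 The crux modulo its deep twins is the residual (R) -/

/-- **19562 ∧ (R) ⟹ crux 19599 `ShallowEqDeepOffKatoStratum` BY NAME.** `hU` = the UPPER twin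
`DeepUpperAtThreeOffKatoStratum` (item 19562, verbatim by name); `hR` = the displayed residual (R): binders
of the crux verbatim, conclusion `∂⁽⁰⁾(δ̃) ≤ ord₃ #Ш(E/ℚ)(3) + ∂^{(∞)}(δ̃)` («`3^{a−s}` divides every
cyclic-level Kurihara number»; Kim's clause (6), lower-bound half, at `p = 3`). At a row: `s + d ≤ a ≤ s + ∂`
gives `d ≤ ∂`. [cite: Kim2022StructureSelmer, Thm. 1.9 (6), §1.5.1 (PDF p. 7)] [cite: MazurRubin2004, Def. 5.2.11, Thm. 5.2.12] -/
theorem shallowEqDeepOffKatoStratum_of_deepUpperOff_of_residual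
    (hU : DeepUpperAtThreeOffKatoStratum)
    (hR : ∀ (W₀ : WeierstrassCurve ℚ) [W₀.IsElliptic] [W₀.IsGloballyMinimal],
      (∀ n : ℕ, W₀.HasSurjectiveModNGaloisRep (3 ^ n : ℕ)) →
      Nat.card {Q : (W₀.baseChange ℚ_[3]).toAffine.Point // (3 : ℕ) • Q = 0} = 1 → Finite W₀.sha →
      ∀ {N : ℕ} [NeZero N], N = W₀.conductorNorm ℤ →
      ∀ (D₀ : ModularParametrizationData W₀ N),
        (∀ z ∈ D₀.L.lattice, ∃ w ∈ periodLattice D₀.f, z = D₀.c * w) →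
        (∀ (W₂ : WeierstrassCurve ℚ) [W₂.IsElliptic] (D₂ : ModularParametrizationData W₂ N),
          D₂.f = D₀.f → D₀.modularDegree ≤ D₂.modularDegree) →
        (∀ r : ℚ, ratPlusSymbol D₀.f r ≠ 0 → 0 ≤ padicValRat 3 (ratPlusSymbol D₀.f r)) →
        kuriharaVanishingOrder W₀ 3 D₀.f = 0 →
        ¬ ((haveI : Fact (Nat.Prime 3) := ⟨Nat.prime_three⟩; Addv W₀ 3) ∧
            ¬ 3 ∣ (W₀.baseChange ℚ_[3]).localTamagawaNumber ℤ_[3] ∧ ¬ (3 : ℤ) ∣ D₀.maninConstant) →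
        kuriharaPartial W₀ 3 D₀.f 0 ≤
          (padicValNat 3 (Nat.card (AddCommGroup.primaryComponent W₀.sha 3)) : ℕ∞) +
            kuriharaPartialInfty W₀ 3 D₀.f) :
    ShallowEqDeepOffKatoStratum := by
  intro W₀ _ _ htow ht hfin N _ hN D₀ hopt hdeg hint hord hoff
  -- the upper twin's stratum condition carries the extra conjunct `#E(ℚ₃)[3] = 1`, which holds here
  have hoffU : ¬ ((haveI : Fact (Nat.Prime 3) := ⟨Nat.prime_three⟩; Addv W₀ 3) ∧
      ¬ 3 ∣ (W₀.baseChange ℚ_[3]).localTamagawaNumber ℤ_[3] ∧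
      Nat.card {Q : (W₀.baseChange ℚ_[3]).toAffine.Point // (3 : ℕ) • Q = 0} = 1 ∧
      ¬ (3 : ℤ) ∣ D₀.maninConstant) :=
    fun h => hoff ⟨h.1, h.2.1, h.2.2.2⟩
  exact shallowEqDeep_conclusion_of_upperRow_of_le_add_partialInfty W₀ 3 D₀.f
    (hU W₀ htow hfin hN D₀ hopt hdeg hint hord hoffU)
    (hR W₀ htow ht hfin hN D₀ hopt hdeg hint hord hoff)

/-- **Necessity: 19679 ∧ 19599 ⟹ (R).** `hL` = the LOWER twin `DeepLowerAtThreeOffKatoStratum` (item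
19679, by name), `hS` = the crux (item 19599, by name); at a row `a ≤ s + d ≤ s + ∂`.
[cite: Kim2022StructureSelmer, Thm. 1.9 (6), §1.5.1 (PDF p. 7)] [cite: MazurRubin2004, Def. 5.2.11] -/
theorem residual_of_deepLowerOff_of_shallowEqDeepOff
    (hL : DeepLowerAtThreeOffKatoStratum) (hS : ShallowEqDeepOffKatoStratum) :
    ∀ (W₀ : WeierstrassCurve ℚ) [W₀.IsElliptic] [W₀.IsGloballyMinimal],
      (∀ n : ℕ, W₀.HasSurjectiveModNGaloisRep (3 ^ n : ℕ)) →
      Nat.card {Q : (W₀.baseChange ℚ_[3]).toAffine.Point // (3 : ℕ) • Q = 0} = 1 → Finite W₀.sha →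
      ∀ {N : ℕ} [NeZero N], N = W₀.conductorNorm ℤ →
      ∀ (D₀ : ModularParametrizationData W₀ N),
        (∀ z ∈ D₀.L.lattice, ∃ w ∈ periodLattice D₀.f, z = D₀.c * w) →
        (∀ (W₂ : WeierstrassCurve ℚ) [W₂.IsElliptic] (D₂ : ModularParametrizationData W₂ N),
          D₂.f = D₀.f → D₀.modularDegree ≤ D₂.modularDegree) →
        (∀ r : ℚ, ratPlusSymbol D₀.f r ≠ 0 → 0 ≤ padicValRat 3 (ratPlusSymbol D₀.f r)) →
        kuriharaVanishingOrder W₀ 3 D₀.f = 0 →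
        ¬ ((haveI : Fact (Nat.Prime 3) := ⟨Nat.prime_three⟩; Addv W₀ 3) ∧
            ¬ 3 ∣ (W₀.baseChange ℚ_[3]).localTamagawaNumber ℤ_[3] ∧ ¬ (3 : ℤ) ∣ D₀.maninConstant) →
        kuriharaPartial W₀ 3 D₀.f 0 ≤
          (padicValNat 3 (Nat.card (AddCommGroup.primaryComponent W₀.sha 3)) : ℕ∞) +
            kuriharaPartialInfty W₀ 3 D₀.f := by
  intro W₀ _ _ htow ht hfin N _ hN D₀ hopt hdeg hint hord hoff
  have hoffL : ¬ ((haveI : Fact (Nat.Prime 3) := ⟨Nat.prime_three⟩; Addv W₀ 3) ∧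
      ¬ 3 ∣ (W₀.baseChange ℚ_[3]).localTamagawaNumber ℤ_[3] ∧
      Nat.card {Q : (W₀.baseChange ℚ_[3]).toAffine.Point // (3 : ℕ) • Q = 0} = 1 ∧
      ¬ (3 : ℤ) ∣ D₀.maninConstant) :=
    fun h => hoff ⟨h.1, h.2.1, h.2.2.2⟩
  exact le_add_partialInfty_of_lowerRow_of_shallowEqDeep_conclusion W₀ 3 D₀.f
    (hL W₀ htow hfin hN D₀ hopt hdeg hint hord hoffL)
    (hS W₀ htow ht hfin hN D₀ hopt hdeg hint hord hoff)

/-- **(R) ⟹ the LOWER twin 19679 on its `E(ℚ₃)[3] = 0` rows** (displayed: item 19679's statement with the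
binder `#E(ℚ₃)[3] = 1` inserted): at a row `a ≤ s + ∂ ≤ s + d` (`kuriharaPartialInfty_le_kuriharaPartialDeepInfty`),
and `d ≤ a < ⊤` in analytic rank `0`, so `d` is a natural number. Thus (R) is STRONGER than the `t = 0`
part of 19679 and, with 19562, equivalent to {19599, 19679 at `t = 0`}. [cite: MazurRubin2004, Def. 5.2.11, Thm. 5.2.12 (i)]
[cite: Kim2022StructureSelmer, §1.5.1 (PDF p. 7)] -/
theorem deepLowerOff_torsionFree_of_residual
    (hR : ∀ (W₀ : WeierstrassCurve ℚ) [W₀.IsElliptic] [W₀.IsGloballyMinimal],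
      (∀ n : ℕ, W₀.HasSurjectiveModNGaloisRep (3 ^ n : ℕ)) →
      Nat.card {Q : (W₀.baseChange ℚ_[3]).toAffine.Point // (3 : ℕ) • Q = 0} = 1 → Finite W₀.sha →
      ∀ {N : ℕ} [NeZero N], N = W₀.conductorNorm ℤ →
      ∀ (D₀ : ModularParametrizationData W₀ N),
        (∀ z ∈ D₀.L.lattice, ∃ w ∈ periodLattice D₀.f, z = D₀.c * w) →
        (∀ (W₂ : WeierstrassCurve ℚ) [W₂.IsElliptic] (D₂ : ModularParametrizationData W₂ N),
          D₂.f = D₀.f → D₀.modularDegree ≤ D₂.modularDegree) →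
        (∀ r : ℚ, ratPlusSymbol D₀.f r ≠ 0 → 0 ≤ padicValRat 3 (ratPlusSymbol D₀.f r)) →
        kuriharaVanishingOrder W₀ 3 D₀.f = 0 →
        ¬ ((haveI : Fact (Nat.Prime 3) := ⟨Nat.prime_three⟩; Addv W₀ 3) ∧
            ¬ 3 ∣ (W₀.baseChange ℚ_[3]).localTamagawaNumber ℤ_[3] ∧ ¬ (3 : ℤ) ∣ D₀.maninConstant) →
        kuriharaPartial W₀ 3 D₀.f 0 ≤
          (padicValNat 3 (Nat.card (AddCommGroup.primaryComponent W₀.sha 3)) : ℕ∞) +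
            kuriharaPartialInfty W₀ 3 D₀.f) :
    ∀ (W₀ : WeierstrassCurve ℚ) [W₀.IsElliptic] [W₀.IsGloballyMinimal],
      (∀ n : ℕ, W₀.HasSurjectiveModNGaloisRep (3 ^ n : ℕ)) →
      Nat.card {Q : (W₀.baseChange ℚ_[3]).toAffine.Point // (3 : ℕ) • Q = 0} = 1 → Finite W₀.sha →
      ∀ {N : ℕ} [NeZero N], N = W₀.conductorNorm ℤ →
      ∀ (D₀ : ModularParametrizationData W₀ N),
        (∀ z ∈ D₀.L.lattice, ∃ w ∈ periodLattice D₀.f, z = D₀.c * w) →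
        (∀ (W₂ : WeierstrassCurve ℚ) [W₂.IsElliptic] (D₂ : ModularParametrizationData W₂ N),
          D₂.f = D₀.f → D₀.modularDegree ≤ D₂.modularDegree) →
        (∀ r : ℚ, ratPlusSymbol D₀.f r ≠ 0 → 0 ≤ padicValRat 3 (ratPlusSymbol D₀.f r)) →
        kuriharaVanishingOrder W₀ 3 D₀.f = 0 →
        ¬ ((haveI : Fact (Nat.Prime 3) := ⟨Nat.prime_three⟩; Addv W₀ 3) ∧
            ¬ 3 ∣ (W₀.baseChange ℚ_[3]).localTamagawaNumber ℤ_[3] ∧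
            Nat.card {Q : (W₀.baseChange ℚ_[3]).toAffine.Point // (3 : ℕ) • Q = 0} = 1 ∧
            ¬ (3 : ℤ) ∣ D₀.maninConstant) →
        ∃ d : ℕ, kuriharaPartialDeepInfty W₀ 3 D₀.f = d ∧
          kuriharaPartial W₀ 3 D₀.f 0 ≤
            ((padicValNat 3 (Nat.card (AddCommGroup.primaryComponent W₀.sha 3)) + d : ℕ) : ℕ∞) := by
  intro W₀ _ _ htow ht hfin N _ hN D₀ hopt hdeg hint hord hoffL
  have hoff : ¬ ((haveI : Fact (Nat.Prime 3) := ⟨Nat.prime_three⟩; Addv W₀ 3) ∧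
      ¬ 3 ∣ (W₀.baseChange ℚ_[3]).localTamagawaNumber ℤ_[3] ∧ ¬ (3 : ℤ) ∣ D₀.maninConstant) :=
    fun h => hoffL ⟨h.1, h.2.1, ht, h.2.2⟩
  have hrow := hR W₀ htow ht hfin hN D₀ hopt hdeg hint hord hoff
  -- `d ≤ a < ⊤`: the deep limit is a natural number in analytic rank `0`
  have hfin0 : kuriharaPartial W₀ 3 D₀.f 0 < ⊤ := by
    rw [kuriharaPartial_zero]
    exact kuriharaDivIndex_one_lt_top_of_kuriharaVanishingOrder_eq_zero W₀ 3 D₀.f hord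
  have hdfin : kuriharaPartialDeepInfty W₀ 3 D₀.f < ⊤ :=
    lt_of_le_of_lt (kuriharaPartialDeepInfty_le_kuriharaPartial_zero W₀ 3 D₀.f) hfin0
  obtain ⟨d, hd⟩ : ∃ d : ℕ, kuriharaPartialDeepInfty W₀ 3 D₀.f = d :=
    (ENat.ne_top_iff_exists.mp hdfin.ne).imp fun d h => h.symm
  refine ⟨d, hd, hrow.trans ?_⟩
  rw [Nat.cast_add, ← hd]
  exact add_le_add le_rfl (kuriharaPartialInfty_le_kuriharaPartialDeepInfty W₀ 3 D₀.f)

/-- **Reading of record for the planner: GRANTED both deep twins (19562, 19679), the crux 19599 is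
EQUIVALENT to the residual (R).** [cite: Kim2022StructureSelmer, Thm. 1.9 (6), §1.5.1 (PDF p. 7)]
[cite: MazurRubin2004, Thm. 5.2.12] -/
theorem shallowEqDeepOffKatoStratum_iff_residual_of_twins
    (hU : DeepUpperAtThreeOffKatoStratum) (hL : DeepLowerAtThreeOffKatoStratum) :
    ShallowEqDeepOffKatoStratum ↔
    ∀ (W₀ : WeierstrassCurve ℚ) [W₀.IsElliptic] [W₀.IsGloballyMinimal],
      (∀ n : ℕ, W₀.HasSurjectiveModNGaloisRep (3 ^ n : ℕ)) →
      Nat.card {Q : (W₀.baseChange ℚ_[3]).toAffine.Point // (3 : ℕ) • Q = 0} = 1 → Finite W₀.sha →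
      ∀ {N : ℕ} [NeZero N], N = W₀.conductorNorm ℤ →
      ∀ (D₀ : ModularParametrizationData W₀ N),
        (∀ z ∈ D₀.L.lattice, ∃ w ∈ periodLattice D₀.f, z = D₀.c * w) →
        (∀ (W₂ : WeierstrassCurve ℚ) [W₂.IsElliptic] (D₂ : ModularParametrizationData W₂ N),
          D₂.f = D₀.f → D₀.modularDegree ≤ D₂.modularDegree) →
        (∀ r : ℚ, ratPlusSymbol D₀.f r ≠ 0 → 0 ≤ padicValRat 3 (ratPlusSymbol D₀.f r)) →
        kuriharaVanishingOrder W₀ 3 D₀.f = 0 →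
        ¬ ((haveI : Fact (Nat.Prime 3) := ⟨Nat.prime_three⟩; Addv W₀ 3) ∧
            ¬ 3 ∣ (W₀.baseChange ℚ_[3]).localTamagawaNumber ℤ_[3] ∧ ¬ (3 : ℤ) ∣ D₀.maninConstant) →
        kuriharaPartial W₀ 3 D₀.f 0 ≤
          (padicValNat 3 (Nat.card (AddCommGroup.primaryComponent W₀.sha 3)) : ℕ∞) +
            kuriharaPartialInfty W₀ 3 D₀.f :=
  ⟨fun hS => residual_of_deepLowerOff_of_shallowEqDeepOff hL hS,
    fun hR => shallowEqDeepOffKatoStratum_of_deepUpperOff_of_residual hU hR⟩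

/-! ### §2 (R) is implied by the route's leaf -/

/-- **The route's LEAF implies (R)**: `N11.KimAtThreeRankZeroPUB` gives, on every tower row with
`E(ℚ₃)[3] = 0`, `∂^{(∞)}(δ̃) = d` and `∂⁽⁰⁾(δ̃) = ord₃ #Ш(E/ℚ)(3) + d`, whence `a ≤ s + ∂` (with equality).
So (R) is a NECESSARY condition for the registered leaf the route closes: displaying it as the residual
of 19599 loses nothing. (Read at the datum's own newform `D₀.f`, `D₀.isNewformOf`.)
[cite: Kim2025RefinedTNC, Thm. 1.1] [cite: Kim2022StructureSelmer, Thm. 1.9 (6)] -/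
theorem residual_of_leaf
    (hleaf : Summit.BirchSwinnertonDyer.Rank1Residual.Additive.N11.KimAtThreeRankZeroPUB) :
    ∀ (W₀ : WeierstrassCurve ℚ) [W₀.IsElliptic] [W₀.IsGloballyMinimal],
      (∀ n : ℕ, W₀.HasSurjectiveModNGaloisRep (3 ^ n : ℕ)) →
      Nat.card {Q : (W₀.baseChange ℚ_[3]).toAffine.Point // (3 : ℕ) • Q = 0} = 1 → Finite W₀.sha →
      ∀ {N : ℕ} [NeZero N], N = W₀.conductorNorm ℤ →
      ∀ (D₀ : ModularParametrizationData W₀ N),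
        (∀ z ∈ D₀.L.lattice, ∃ w ∈ periodLattice D₀.f, z = D₀.c * w) →
        (∀ (W₂ : WeierstrassCurve ℚ) [W₂.IsElliptic] (D₂ : ModularParametrizationData W₂ N),
          D₂.f = D₀.f → D₀.modularDegree ≤ D₂.modularDegree) →
        (∀ r : ℚ, ratPlusSymbol D₀.f r ≠ 0 → 0 ≤ padicValRat 3 (ratPlusSymbol D₀.f r)) →
        kuriharaVanishingOrder W₀ 3 D₀.f = 0 →
        ¬ ((haveI : Fact (Nat.Prime 3) := ⟨Nat.prime_three⟩; Addv W₀ 3) ∧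
            ¬ 3 ∣ (W₀.baseChange ℚ_[3]).localTamagawaNumber ℤ_[3] ∧ ¬ (3 : ℤ) ∣ D₀.maninConstant) →
        kuriharaPartial W₀ 3 D₀.f 0 ≤
          (padicValNat 3 (Nat.card (AddCommGroup.primaryComponent W₀.sha 3)) : ℕ∞) +
            kuriharaPartialInfty W₀ 3 D₀.f := by
  intro W₀ _ _ htow ht hfin N _ _ D₀ _ _ hint hord _
  obtain ⟨d, hd, ha⟩ := hleaf W₀ htow ht hfin D₀.f D₀.isNewformOf hint hord
  rw [ha, hd, Nat.cast_add]

end Summit.BirchSwinnertonDyer.BirchSwinnertonDyer.Theorems.KimAtThreeShallowEqDeepOffStratumResidual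

end
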